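import Summits.QuantumFields.YangMills.Theorems.LuscherReductionTwistedTraceScalingBTColourFP
import Summits.QuantumFields.YangMills.Theorems.LuscherReductionTwistedTraceScalingRecordBricks
import Summits.QuantumFields.YangMills.Theorems.LuscherReductionTwistedTraceScalingOrthoTransverseRotation
import HarnessLib

/-!
# The fibre mass of a colour-blind frozen profile against the record soft weight is COLOUR INVARIANT: `mass(c·u·c⁻¹) = mass(u)` — the `hΩinv` input of the normalised profile
# `Ω_u = √(γ/mass(u))·Ω`
# (route `FlatTubeReduction`, crux K1 `NearFlatRatioLaw` stmt-QuantumFields-24720; seat `ym-line-ftr-p1` g14; rate twin «ratepack-v3 / frozen fibres»; R2b1 RECORD rung — no summit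
# statement is proved here)

WHY (memo `Cruxes/NearFlatRatioLaw/Lines/ratepack-v3-frozen-g12.md` §8.2).  The (B-N) brick at rate is made EXACT by the fibrewise normalisation `n(u) = √(γ/mass(u))`
(`…ProfileNormalisation.fibreMassAd_normalise`); the hand-off object asks the profile to be colour EQUIVARIANT (`AnalyticRatePotInput.hΩinv`: `Ω(cuc⁻¹, Ad_c v) = Ω(u, v)`), so `n`,
i.e. the fibre mass, must be invariant under the constant conjugation of the slow datum.  Change of variables `v ↦ Ad_c v` in the transverse measure
(`integral_orthoTransverse_colourRotate`), `(orthoTube u v)^{c} = orthoTube (cuc⁻¹) (Ad_c v)` (the disprover's R33 `gaugeTransform_const_orthoTube`), colour invariance of the soft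
record weight (`softWeight_recordChi_props`) and of the profile.
* ★ `fibreMass_recordChi_conj`, `fibreMass_recordChi_gaugeTransform` (every one-site gauge transformation is constant: `Avg.gaugeTransform_one_site_eq_const`).
HONEST FRAMING: symmetry bookkeeping; femto rung R2b1 (RECORD label); not infinite volume, not a gap, not Clay.  No defs, no named facts, no `sorry`.
-/

set_option autoImplicit false

noncomputable section

open MeasureTheory Filter Topology Real
open scoped BigOperators
open Literature.MathematicalPhysics.QuantumFieldTheory
open Literature.MathematicalPhysics.QuantumLattice

namespace Summit.QuantumFields.YangMills.Theorems.FemtoTransferGap.TwoLattice.ConstTube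

open Summit.QuantumFields.YangMills.Theorems.FemtoTransferGap
open Summit.QuantumFields.YangMills.Theorems.FemtoTransferGap.TwoLattice.Avg
open Summit.QuantumFields.YangMills.Theorems.FemtoTransferGap.TwoLattice.Stiff (LinkSpace)
open Summit.QuantumFields.YangMills.Theorems.TwistedTraceScaling.Negative.R33 (gaugeTransform_const_orthoTube)

variable {L : ℕ} [NeZero L]

/-- ★ **Colour invariance of the fibre mass** (record soft weight, colour-blind frozen profile): `fibreMass (N/χ) Ω (cuc⁻¹) = fibreMass (N/χ) Ω u`. [cite: Luscher1983, §3] -/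
theorem fibreMass_recordChi_conj (s K M β : ℝ) {Ω : LinkSpace L → ℝ} (hΩm : Measurable Ω) (hΩinv : ∀ (g : SU2) (x : LinkSpace L), Ω (adL L g x) = Ω x)
    (c : SU2) (u : GaugeConfig 3 1 SU2) :
    fibreMass L (softWeight (recordChi L s K M β)) Ω (gaugeTransform (fun _ : Site 3 1 => c) u) = fibreMass L (softWeight (recordChi L s K M β)) Ω u := by
  obtain ⟨hwm, -, -, hwc⟩ := softWeight_recordChi_props (L := L) s K M β
  have hae : ∀ᵐ v ∂orthoTransverse L, v ∈ capBalancedSet L := by rw [ae_iff]; exact orthoTransverse_compl_capBalancedSet L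
  -- the integrand at the conjugated slow datum, as a function of `v`
  have hGm : Measurable fun v : Edge 3 L → Fin 3 → ℝ => Ω (linkEmbed L v) ^ 2 * softWeight (recordChi L s K M β) (orthoTube L (gaugeTransform (fun _ : Site 3 1 => c) u) v) :=
    ((hΩm.comp (measurable_linkEmbed L)).pow_const 2).mul (hwm.comp (measurable_orthoTube_right _))
  unfold fibreMass
  rw [← integral_orthoTransverse_colourRotate L (fun _ => c)
    (fun v => Ω (linkEmbed L v) ^ 2 * softWeight (recordChi L s K M β) (orthoTube L (gaugeTransform (fun _ : Site 3 1 => c) u) v)) hGm]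
  refine integral_congr_ae (hae.mono fun v hv => ?_)
  dsimp only
  rw [linkEmbed_colourRotate_const, hΩinv, ← gaugeTransform_const_orthoTube c u (sum_sq_le_one_of_cap L hv.2), hwc]

/-- The same for an arbitrary one-site gauge transformation. [folklore] -/
theorem fibreMass_recordChi_gaugeTransform (s K M β : ℝ) {Ω : LinkSpace L → ℝ} (hΩm : Measurable Ω) (hΩinv : ∀ (g : SU2) (x : LinkSpace L), Ω (adL L g x) = Ω x)
    (g : Site 3 1 → SU2) (u : GaugeConfig 3 1 SU2) :
    fibreMass L (softWeight (recordChi L s K M β)) Ω (gaugeTransform g u) = fibreMass L (softWeight (recordChi L s K M β)) Ω u := by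
  rw [gaugeTransform_one_site_eq_const, fibreMass_recordChi_conj s K M β hΩm hΩinv]

end Summit.QuantumFields.YangMills.Theorems.FemtoTransferGap.TwoLattice.ConstTube

end
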